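import Literature.NumberTheory.EllipticCurves.Sprung2017.SharpFlatPAdicLFunctionProofs
import Literature.NumberTheory.EllipticCurves.Sprung2017.MAdicLimitProofs
import Mathlib.NumberTheory.Padics.RingHoms
import HarnessLib

/-!
# Sprung's pair `(L♯, L♭)` is DETERMINED by the Mazur–Tate congruences (proofs; no named fact)

Topic `Literature/NumberTheory/EllipticCurves`, cluster `Sprung2017`; sibling PROOF file of
`SharpFlatPAdicLFunction.lean` (p212436: the predicate `IsSprungPair f p a_p L♯ L♭`, "`θ_n ≡
−(u_n L♯ + v_n L♭) (mod ω_n)` for every `n`", and the named fact `thm112_exists_isSprungPair`) and of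
`SharpFlatPAdicLFunctionProofs.lean` (p213581: EXISTENCE, `thm112_exists_isSprungPair_holds`).
F. Sprung, *On pairs of `p`-adic `L`-functions for weight-two modular forms*, Algebra Number Theory
11 (2017) 885–928 [Sprung2017], **Theorem 1.12**: "When `p` is supersingular, there is a UNIQUE
vector of two Iwasawa functions `(L̂_p^♯(f,ωⁱ,T), L̂_p^♭(f,ωⁱ,T)) ∈ Λ^{⊕2}` so that …"; the module
docstring of the existence file records "NOT proved here (and not part of the fact): uniqueness".
This file PROVES uniqueness (`IsSprungPair.unique`): for `p ∣ a_p` (supersingular), two Sprung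
pairs for the same form are EQUAL. Consequently (`existsUnique_isSprungPair`) "for every Sprung pair"
in the cell's statements (`Summit.….Supersingular.*`: the X8 = `a_3 = ±3` readings, the per-pair
two-engine certificates `(μ, λ)(L^•) = (0, 1)`) refers to ONE well-defined pair `(L♯_p(E), L♭_p(E))`
— the typed statements are thereby not stronger than the printed theorem on this count. Everything
is proved (net debt 0). HONEST FRAMING (cell `b2b-bsdres`, supersingular family, X8 prover B = unit
`b2b-bsdres-additive-p3`, gen 4): nothing about any curve is asserted; no label of the cell moves.

## Argument (`α`-free; replaces Sprung's passage through `𝓛og_{α,β}` over `ℂ_p`)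

Sprung proves uniqueness inside Thm. 1.12 / "Theorem (maintheorem)" by inverting the logarithm
matrix (`det 𝓛og ≠ 0`, Remark 3.1) over `ℂ_p`. Here, purely in `Λ = ℤ_p⟦T⟧`:
1. (`IsCongrModOmega.exists_mul_sub_eq`) two solutions `L₁, L₂` of ONE congruence
   `θ ≡ ω·L (mod ω_n)` in `Λ ⊗ ℚ_p` satisfy `ω·(L₁ − L₂) ∈ ω_n Λ` INTEGRALLY: subtracting the two
   witnesses gives `p^M ω (L₁ − L₂) ∈ ω_n Λ`, and `p^M x ∈ ω_n Λ ⇒ x ∈ ω_n Λ` because `ω_n` is not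
   divisible by the prime `p` of `Λ` (its image in `𝔽_p⟦T⟧` has coefficient `1` at `T^{pⁿ}`);
2. hence the differences `a = L♯ − L♯'`, `b = L♭ − L♭'` of two Sprung pairs satisfy
   `u_n a + v_n b = ω_n r_n` for all `n`; eliminating with the WRONSKIAN
   `u_{n+1} v_n − v_{n+1} u_n = ∏_{i≤n} Φ_{p^i}(1+T) = ω_n/T` (`sharpPoly_succ_mul_flatPoly_sub`) gives
   `a = T·(v_n Φ_{p^{n+1}}(1+T) r_{n+1} − v_{n+1} r_n)` and `b = T·(u_{n+1} r_n − u_n Φ_{p^{n+1}}(1+T) r_{n+1})`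
   for EVERY `n`;
3. `u_n, v_n ∈ (p, T)^{⌊n/2⌋}` when `p ∣ a_p` (`pow_dvd_coeff_map_sprungSeq`: Sprung's "`𝔐 = 0`"), so
   the `j`-th coefficient of `a` is divisible by `p^{⌊n/2⌋ − j}` for every `n`, i.e. by every power of
   `p`: `a = 0`, and likewise `b = 0` (Krull intersection, coefficientwise).

## Contents

* `IsCongrModOmega.exists_mul_sub_eq` — step 1 (general `θ`, `ω`; reusable for any congruence of the
  tree's shape `IsCongrModOmega`);
* `IsSprungPair.unique`, `IsSprungPair.chromaticL_eq` — **two Sprung pairs are equal**;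
* `existsUnique_isSprungPair` — with `thm112_exists_isSprungPair_holds`: for `p ≠ 2`, `f` the newform
  of `E`, good reduction and `p ∣ a_p`, there is EXACTLY ONE pair.

References: [Sprung2017] Thm. 1.12, Remark 3.1 (`det 𝓛og = log_p(1+X)/X ~ ∏ Φ`), §4 Cor. 4.4 and
"Proposition (𝔐 = 0)"; [Pollack2003] Prop. 6.18 (shape of the congruences); S. Lang, *Cyclotomic
Fields I–II*, GTM 121, Ch. 5 §1 (the `(p,T)`-adic topology of `Λ`).
-/

set_option autoImplicit false

noncomputable section

open scoped MatrixGroups ModularForm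

open CongruenceSubgroup Polynomial Literature.NumberTheory.EllipticCurves
  Literature.NumberTheory.EllipticCurves.ModularForms

namespace Literature.NumberTheory.EllipticCurves

variable {p : ℕ} [hp : Fact p.Prime]

/-! ### Step 1: integral differences of solutions of one congruence -/

section Integral

/-- The coefficient of `T^{pⁿ}` in `ω_n = (1+T)^{pⁿ} − 1 ∈ ℤ[T]` is `1`. [folklore] -/
private theorem coeff_cyclotomicOmega_self (n : ℕ) : (cyclotomicOmega p n).coeff (p ^ n) = 1 := by
  have hne : p ^ n ≠ 0 := (pow_pos hp.out.pos n).ne'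
  rw [cyclotomicOmega, coeff_sub, coeff_X_add_one_pow, Nat.choose_self, coeff_one, if_neg hne]
  simp

/-- If `ω_n · r = p · y` in `Λ = ℤ_p⟦T⟧` then `p` divides every coefficient of `r`: reduce modulo `p`
to the domain `𝔽_p⟦T⟧`, where `ω_n` maps to a non-zero element (coefficient `1` at `T^{pⁿ}`).
[folklore] -/
private theorem dvd_coeff_of_omega_mul_eq_C_mul (n : ℕ) {r y : PowerSeries ℤ_[p]}
    (h : ((cyclotomicOmega p n).map (Int.castRingHom ℤ_[p]) : PowerSeries ℤ_[p]) * r =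
      PowerSeries.C (p : ℤ_[p]) * y) (j : ℕ) :
    (p : ℤ_[p]) ∣ PowerSeries.coeff j r := by
  set φ : PowerSeries ℤ_[p] →+* PowerSeries (ZMod p) := PowerSeries.map (PadicInt.toZMod (p := p))
    with hφ
  have hφp : φ (PowerSeries.C (p : ℤ_[p])) = 0 := by
    rw [hφ, PowerSeries.map_C, map_natCast, ZMod.natCast_self, map_zero]
  have hω : φ ((cyclotomicOmega p n).map (Int.castRingHom ℤ_[p]) : PowerSeries ℤ_[p]) ≠ 0 := by
    intro h0
    have h1 := congrArg (PowerSeries.coeff (p ^ n)) h0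
    rw [hφ, PowerSeries.coeff_map, Polynomial.coeff_coe, Polynomial.coeff_map,
      coeff_cyclotomicOmega_self, map_one, map_one, map_zero] at h1
    exact one_ne_zero h1
  have hprod : φ ((cyclotomicOmega p n).map (Int.castRingHom ℤ_[p]) : PowerSeries ℤ_[p]) * φ r = 0 := by
    rw [← map_mul, h, map_mul, hφp, zero_mul]
  have hr : φ r = 0 := (mul_eq_zero.mp hprod).resolve_left hω
  have hj := congrArg (PowerSeries.coeff j) hr
  rw [hφ, PowerSeries.coeff_map, map_zero] at hj
  have hmem : PowerSeries.coeff j r ∈ RingHom.ker (PadicInt.toZMod (p := p)) := hj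
  rwa [PadicInt.ker_toZMod, PadicInt.maximalIdeal_eq_span_p, Ideal.mem_span_singleton] at hmem

/-- The constant `p ∈ Λ` is non-zero. [folklore] -/
private theorem C_natCast_ne_zero : (PowerSeries.C (p : ℤ_[p]) : PowerSeries ℤ_[p]) ≠ 0 := by
  intro h0
  have h1 : (p : ℤ_[p]) = 0 := PowerSeries.C_injective (h0.trans (map_zero _).symm)
  exact hp.out.ne_zero (by exact_mod_cast h1)

/-- **`p^M · x ∈ ω_n Λ ⇒ x ∈ ω_n Λ`** in `Λ = ℤ_p⟦T⟧`: `ω_n` is prime to `p` (induction on `M`,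
peeling one factor `p` off the cofactor by `dvd_coeff_of_omega_mul_eq_C_mul`). [folklore] -/
private theorem exists_eq_omega_mul_of_C_pow_mul_eq (n : ℕ) :
    ∀ (M : ℕ) {x r : PowerSeries ℤ_[p]},
      PowerSeries.C ((p : ℤ_[p]) ^ M) * x =
        ((cyclotomicOmega p n).map (Int.castRingHom ℤ_[p]) : PowerSeries ℤ_[p]) * r →
      ∃ r' : PowerSeries ℤ_[p],
        x = ((cyclotomicOmega p n).map (Int.castRingHom ℤ_[p]) : PowerSeries ℤ_[p]) * r' := by
  intro M
  induction M with
  | zero =>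
    intro x r h
    exact ⟨r, by simpa using h⟩
  | succ M ih =>
    intro x r h
    have hdiv : ∀ j, (p : ℤ_[p]) ∣ PowerSeries.coeff j r := fun j ↦
      dvd_coeff_of_omega_mul_eq_C_mul n (y := PowerSeries.C ((p : ℤ_[p]) ^ M) * x)
        (by rw [← h, pow_succ', map_mul, mul_assoc]) j
    choose c hc using hdiv
    have hr : r = PowerSeries.C (p : ℤ_[p]) * PowerSeries.mk c := by
      ext j
      rw [PowerSeries.coeff_C_mul, PowerSeries.coeff_mk]
      exact hc j
    have h2 : PowerSeries.C (p : ℤ_[p]) * (PowerSeries.C ((p : ℤ_[p]) ^ M) * x) =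
        PowerSeries.C (p : ℤ_[p]) *
          (((cyclotomicOmega p n).map (Int.castRingHom ℤ_[p]) : PowerSeries ℤ_[p]) *
            PowerSeries.mk c) := by
      rw [← mul_assoc, ← map_mul, ← pow_succ', h, hr]
      ring
    exact ih (mul_left_cancel₀ C_natCast_ne_zero h2)

/-- `ι(p^m) = p^m` for the inclusion `ι : Λ ↪ ℚ_p⟦T⟧`. [folklore] -/
private theorem iwasawaToPowerSeries_C_pow (m : ℕ) :
    iwasawaToPowerSeries p (PowerSeries.C ((p : ℤ_[p]) ^ m)) = PowerSeries.C ((p : ℚ_[p]) ^ m) := by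
  rw [iwasawaToPowerSeries, PowerSeries.map_C, map_pow, map_natCast]

/-- **Two solutions of one congruence differ integrally by a multiple of `ω_n`.** If
`θ ≡ ω·L₁ (mod ω_n)` and `θ ≡ ω·L₂ (mod ω_n)` in `Λ ⊗ ℚ_p` (the tree's `IsCongrModOmega`: some
`p^m (θ − ω L) ∈ ω_n Λ`), then `ω·(L₁ − L₂) = ω_n · r` for some `r ∈ Λ = ℤ_p⟦T⟧` — the `p`-powers
are removed because `ω_n ∉ (p)`. Step 1 of the uniqueness of Sprung's pair (and of Pollack's
`L^±`: Sprung 2017 Thm. 1.12 "unique"; Pollack 2003 Prop. 6.18). [cite: Sprung2017, Thm. 1.12 (uniqueness)] -/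
theorem IsCongrModOmega.exists_mul_sub_eq {n : ℕ} {θ : ℚ[X]} {ω : ℤ[X]} {L₁ L₂ : IwasawaAlgebra p}
    (h₁ : IsCongrModOmega p n θ ω L₁) (h₂ : IsCongrModOmega p n θ ω L₂) :
    ∃ r : IwasawaAlgebra p,
      (((Polynomial.map (Int.castRingHom ℤ_[p]) ω : ℤ_[p][X]) : PowerSeries ℤ_[p]) * (L₁ - L₂)) =
        ((cyclotomicOmega p n).map (Int.castRingHom ℤ_[p]) : PowerSeries ℤ_[p]) * r := by
  obtain ⟨m₁, q₁, e₁⟩ := h₁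
  obtain ⟨m₂, q₂, e₂⟩ := h₂
  set θ' : PowerSeries ℚ_[p] := (θ.map (algebraMap ℚ ℚ_[p]) : PowerSeries ℚ_[p])
  set ω' : PowerSeries ℤ_[p] :=
    ((Polynomial.map (Int.castRingHom ℤ_[p]) ω : ℤ_[p][X]) : PowerSeries ℤ_[p])
  set Ω : PowerSeries ℤ_[p] :=
    ((cyclotomicOmega p n).map (Int.castRingHom ℤ_[p]) : PowerSeries ℤ_[p])
  simp only [map_mul] at e₁ e₂
  -- `p^{m₁+m₂} ω' (L₁ − L₂) = Ω (p^{m₁} q₂ − p^{m₂} q₁)` in `Λ`, checked after `ι`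
  have key : iwasawaToPowerSeries p (PowerSeries.C ((p : ℤ_[p]) ^ (m₁ + m₂)) * (ω' * (L₁ - L₂))) =
      iwasawaToPowerSeries p
        (Ω * (PowerSeries.C ((p : ℤ_[p]) ^ m₁) * q₂ - PowerSeries.C ((p : ℤ_[p]) ^ m₂) * q₁)) := by
    simp only [map_mul, map_sub, iwasawaToPowerSeries_C_pow, pow_add]
    linear_combination (PowerSeries.C ((p : ℚ_[p]) ^ m₁)) * e₂ -
      (PowerSeries.C ((p : ℚ_[p]) ^ m₂)) * e₁
  exact exists_eq_omega_mul_of_C_pow_mul_eq n (m₁ + m₂) (iwasawaToPowerSeries_injective p key)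

end Integral

namespace Sprung2017

/-! ### Step 2–3: the Wronskian elimination and the `(p,T)`-adic squeeze -/

section Unique

variable {N : ℕ} {f : CuspForm (Gamma0 N) 2}

/-- `toIwasawa` is "map the coefficients to `ℤ_p` and view the polynomial as a power series".
[folklore] -/
private theorem toIwasawa_apply (q : ℤ[X]) :
    toIwasawa p q = ((q.map (Int.castRingHom ℤ_[p]) : ℤ_[p][X]) : PowerSeries ℤ_[p]) := rfl

/-- `toIwasawa T = T`. [folklore] -/
private theorem toIwasawa_X : toIwasawa p (X : ℤ[X]) = PowerSeries.X := by
  rw [toIwasawa_apply, Polynomial.map_X, Polynomial.coe_X]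

/-- The image of `Π_n = ∏_{i<n} Φ_{p^{i+1}}(1+T)` (a monic polynomial) in `Λ` is non-zero.
[folklore] -/
private theorem toIwasawa_prod_cyclotomic_ne_zero (n : ℕ) :
    toIwasawa p (∏ i ∈ Finset.range n, (cyclotomic (p ^ (i + 1)) ℤ).comp (X + 1)) ≠ 0 := by
  have hmonic : (∏ i ∈ Finset.range n, (cyclotomic (p ^ (i + 1)) ℤ).comp (X + 1)).Monic := by
    refine monic_prod_of_monic _ _ fun i _ ↦ (cyclotomic.monic _ ℤ).comp (monic_X_add_C 1) ?_
    rw [← C_1, natDegree_X_add_C]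
    exact one_ne_zero
  rw [toIwasawa_apply, Ne, Polynomial.coe_eq_zero_iff]
  exact (hmonic.map (Int.castRingHom ℤ_[p])).ne_zero

/-- An element of `ℤ_p` divisible by every power of `p` is `0`. [folklore] -/
private theorem padicInt_eq_zero_of_forall_pow_dvd (x : ℤ_[p]) (h : ∀ k : ℕ, (p : ℤ_[p]) ^ k ∣ x) :
    x = 0 := by
  by_contra hx
  have hpos : 0 < ‖x‖ := norm_pos_iff.mpr hx
  have hp1 : ((p : ℝ)⁻¹) < 1 := inv_lt_one_of_one_lt₀ (by exact_mod_cast hp.out.one_lt)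
  have hp0 : 0 ≤ ((p : ℝ)⁻¹) := inv_nonneg.mpr (by exact_mod_cast (Nat.zero_le p))
  obtain ⟨k, hk⟩ := exists_pow_lt_of_lt_one hpos hp1
  have hle : ‖x‖ ≤ (p : ℝ) ^ (-(k : ℤ)) :=
    (PadicInt.norm_le_pow_iff_mem_span_pow x k).mpr (Ideal.mem_span_singleton.mpr (h k))
  rw [zpow_neg, zpow_natCast, ← inv_pow] at hle
  exact absurd (hle.trans_lt hk) (lt_irrefl _)

/-- **Uniqueness of Sprung's pair (Sprung 2017, Thm. 1.12: "there is a unique vector of two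
Iwasawa functions").** For `p ∣ a_p` (good SUPERSINGULAR reduction), two pairs `(L♯, L♭)`,
`(L♯', L♭')` in `Λ²` satisfying the Mazur–Tate congruences `θ_n ≡ −(u_n L♯ + v_n L♭) (mod ω_n)` for
all `n` (`IsSprungPair f p a_p`) are EQUAL. Proof in `Λ` (no `α, β`, no `𝓛og`): the differences
`a, b` satisfy `u_n a + v_n b ∈ ω_n Λ` integrally (`IsCongrModOmega.exists_mul_sub_eq`); the
Wronskian `u_{n+1} v_n − v_{n+1} u_n = ω_n/T` (Sprung's `det 𝒞_1⋯𝒞_n = ∏Φ_{p^i}(1+T)`) solves for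
`a ∈ T·(v_n, v_{n+1})Λ`, `b ∈ T·(u_n, u_{n+1})Λ` for every `n`, and `u_n, v_n ∈ (p,T)^{⌊n/2⌋}`
(Sprung's "`𝔐 = 0`" for supersingular `p`) forces every coefficient of `a`, `b` to be divisible by
all powers of `p`. [cite: Sprung2017, Thm. 1.12 (uniqueness), Remark 3.1 and §4 Cor. 4.4] -/
theorem IsSprungPair.unique {ap : ℤ} (hap : (p : ℤ) ∣ ap) {A B A' B' : IwasawaAlgebra p}
    (h : IsSprungPair f p ap A B) (h' : IsSprungPair f p ap A' B') : A = A' ∧ B = B' := by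
  -- notation: `τ = toIwasawa`, `u n`, `v n`, `Φ n`, `Pr n`, `Ω n`
  set a : IwasawaAlgebra p := A - A' with ha_def
  set b : IwasawaAlgebra p := B - B' with hb_def
  set u : ℕ → IwasawaAlgebra p := fun n ↦ toIwasawa p (sharpPoly ap p n) with hu_def
  set v : ℕ → IwasawaAlgebra p := fun n ↦ toIwasawa p (flatPoly ap p n) with hv_def
  set Φ : ℕ → IwasawaAlgebra p := fun n ↦ toIwasawa p ((cyclotomic (p ^ n) ℤ).comp (X + 1))
    with hΦ_def
  set Pr : ℕ → IwasawaAlgebra p :=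
    fun n ↦ toIwasawa p (∏ i ∈ Finset.range n, (cyclotomic (p ^ (i + 1)) ℤ).comp (X + 1)) with hPr_def
  set Ω : ℕ → IwasawaAlgebra p :=
    fun n ↦ ((cyclotomicOmega p n).map (Int.castRingHom ℤ_[p]) : PowerSeries ℤ_[p]) with hΩ_def
  -- Step 1: integral congruences `u_n a + v_n b = Ω_n r_n`
  have E : ∀ n, ∃ r : IwasawaAlgebra p, u n * a + v n * b = Ω n * r := by
    intro n
    obtain ⟨r, hr⟩ := (h n).exists_mul_sub_eq (h' n)
    have hneg : (((-1 : ℤ[X]).map (Int.castRingHom ℤ_[p]) : ℤ_[p][X]) : PowerSeries ℤ_[p]) = -1 := by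
      rw [Polynomial.map_neg, Polynomial.map_one, Polynomial.coe_neg, Polynomial.coe_one]
    rw [hneg] at hr
    refine ⟨-r, ?_⟩
    simp only [hu_def, hv_def, ha_def, hb_def, hΩ_def]
    linear_combination -hr
  choose r hr using E
  -- the Wronskian, `Ω_n = T·Π_n`, `Ω_{n+1} = Ω_n Φ_{n+1}`
  have W : ∀ n, u (n + 1) * v n - v (n + 1) * u n = Pr n := by
    intro n
    simp only [hu_def, hv_def, hPr_def, ← map_mul, ← map_sub]
    rw [sharpPoly_succ_mul_flatPoly_sub]
  have hΩ : ∀ n, Ω n = toIwasawa p X * Pr n := by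
    intro n
    simp only [hΩ_def, hPr_def, ← map_mul]
    rw [X_mul_prod_cyclotomic_comp_eq_cyclotomicOmega, toIwasawa_apply]
  have hΩsucc : ∀ n, Ω (n + 1) = Ω n * Φ (n + 1) := by
    intro n
    simp only [hΩ_def, hΦ_def]
    rw [cyclotomicOmega_succ, toIwasawa_apply, Polynomial.map_mul, Polynomial.coe_mul]
  have hPr : ∀ n, Pr n ≠ 0 := fun n ↦ toIwasawa_prod_cyclotomic_ne_zero n
  -- Step 2: elimination
  have hA : ∀ n, a = toIwasawa p X * (Φ (n + 1) * r (n + 1) * v n - r n * v (n + 1)) := by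
    intro n
    apply mul_left_cancel₀ (hPr n)
    have e1 := hr n
    have e2 := hr (n + 1)
    rw [hΩsucc, hΩ] at e2
    rw [hΩ] at e1
    linear_combination (v n) * e2 - (v (n + 1)) * e1 - a * W n
  have hB : ∀ n, b = toIwasawa p X * (r n * u (n + 1) - Φ (n + 1) * r (n + 1) * u n) := by
    intro n
    apply mul_left_cancel₀ (hPr n)
    have e1 := hr n
    have e2 := hr (n + 1)
    rw [hΩsucc, hΩ] at e2
    rw [hΩ] at e1
    linear_combination (u (n + 1)) * e1 - (u n) * e2 - b * W n
  -- Step 3: `(p,T)`-adic bounds on `u_n`, `v_n`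
  have hu : ∀ n j, (p : ℤ_[p]) ^ (n / 2 - j) ∣ PowerSeries.coeff j (u n) := by
    intro n j
    simp only [hu_def, toIwasawa_apply, Polynomial.coeff_coe]
    exact pow_dvd_coeff_map_sprungSeq hap 0 1 n j
  have hv : ∀ n j, (p : ℤ_[p]) ^ (n / 2 - j) ∣ PowerSeries.coeff j (v n) := by
    intro n j
    simp only [hv_def, toIwasawa_apply, Polynomial.coeff_coe]
    exact pow_dvd_coeff_map_sprungSeq hap 1 0 n j
  have hu' : ∀ n j, (p : ℤ_[p]) ^ (n / 2 - j) ∣ PowerSeries.coeff j (u (n + 1)) := fun n j ↦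
    (pow_dvd_pow _ (by omega)).trans (hu (n + 1) j)
  have hv' : ∀ n j, (p : ℤ_[p]) ^ (n / 2 - j) ∣ PowerSeries.coeff j (v (n + 1)) := fun n j ↦
    (pow_dvd_pow _ (by omega)).trans (hv (n + 1) j)
  -- coefficients of `a` and `b` are divisible by every power of `p`
  have hcoeffA : ∀ n j, (p : ℤ_[p]) ^ (n / 2 - j) ∣ PowerSeries.coeff (j + 1) a := by
    intro n j
    rw [hA n, toIwasawa_X, PowerSeries.coeff_succ_X_mul, map_sub]
    exact dvd_sub (MAdic.dvd_coeff_mul_of_dvd_coeff p (hv n) _ j)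
      (MAdic.dvd_coeff_mul_of_dvd_coeff p (hv' n) _ j)
  have hcoeffB : ∀ n j, (p : ℤ_[p]) ^ (n / 2 - j) ∣ PowerSeries.coeff (j + 1) b := by
    intro n j
    rw [hB n, toIwasawa_X, PowerSeries.coeff_succ_X_mul, map_sub]
    exact dvd_sub (MAdic.dvd_coeff_mul_of_dvd_coeff p (hu' n) _ j)
      (MAdic.dvd_coeff_mul_of_dvd_coeff p (hu n) _ j)
  have hzero : ∀ x : IwasawaAlgebra p,
      (x = toIwasawa p X * (Φ 1 * r 1 * v 0 - r 0 * v 1) ∨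
        x = toIwasawa p X * (r 0 * u 1 - Φ 1 * r 1 * u 0)) →
      (∀ n j, (p : ℤ_[p]) ^ (n / 2 - j) ∣ PowerSeries.coeff (j + 1) x) → x = 0 := by
    intro x hx0 hx
    ext j
    rw [map_zero]
    cases j with
    | zero =>
      rcases hx0 with hx0 | hx0 <;>
        rw [hx0, toIwasawa_X, PowerSeries.coeff_zero_eq_constantCoeff, map_mul,
          PowerSeries.constantCoeff_X, zero_mul]
    | succ j =>
      refine padicInt_eq_zero_of_forall_pow_dvd _ fun k ↦ ?_
      have hk := hx (2 * (j + k)) j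
      rwa [show 2 * (j + k) / 2 - j = k from by omega] at hk
  have ha0 : a = 0 := hzero a (Or.inl (hA 0)) hcoeffA
  have hb0 : b = 0 := hzero b (Or.inr (hB 0)) hcoeffB
  exact ⟨sub_eq_zero.mp ha0, sub_eq_zero.mp hb0⟩

/-- Two Sprung pairs give the same chromatic `L^•` for either colour. [cite: Sprung2017, Thm. 1.12 (uniqueness)] -/
theorem IsSprungPair.chromaticL_eq {ap : ℤ} (hap : (p : ℤ) ∣ ap) {A B A' B' : IwasawaAlgebra p}
    (h : IsSprungPair f p ap A B) (h' : IsSprungPair f p ap A' B') (c : Chroma) :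
    chromaticL c A B = chromaticL c A' B' := by
  obtain ⟨rfl, rfl⟩ := h.unique hap h'
  rfl

/-- **Exactly one Sprung pair** (existence: `thm112_exists_isSprungPair_holds`, p213581; uniqueness:
`IsSprungPair.unique`): for `p ≠ 2`, `f` the newform of the globally minimal `E = W`, good
reduction at `p` and `p ∣ a_p(E)`, there is a unique `(L♯, L♭) ∈ Λ²` with
`IsSprungPair f p (a_p(E)) L♯ L♭` — Sprung 2017 Thm. 1.12 (supersingular case, trivial tame
character) in full. [cite: Sprung2017, Thm. 1.12] -/
theorem existsUnique_isSprungPair [NeZero N] {W : WeierstrassCurve ℚ} [W.IsElliptic]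
    [W.IsGloballyMinimal] (hp2 : p ≠ 2) (hf : IsNewformOf W f)
    (hgood : W.HasGoodReductionAtPrime p) (hap : (p : ℤ) ∣ W.frobeniusTrace p) :
    ∃! L : IwasawaAlgebra p × IwasawaAlgebra p, IsSprungPair f p (W.frobeniusTrace p) L.1 L.2 := by
  obtain ⟨Ls, Lf, hL⟩ := thm112_exists_isSprungPair_holds (W := W) (f := f) (p := p) hp2 hf hgood hap
  refine ⟨(Ls, Lf), hL, fun L' hL' ↦ ?_⟩
  obtain ⟨h1, h2⟩ := hL'.unique hap hL
  exact Prod.ext h1 h2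

end Unique

end Sprung2017

end Literature.NumberTheory.EllipticCurves

end
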